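import Summits.Ventures.PercRepro.SixFourResidueThreeGenericTen
import Summits.Ventures.PercRepro.SixFourResidueTwoPointsA

/-!
# PercRepro — C-025 at `(6,4)`: Theorem G₃ at `g = 10`, part B — the `3`-point plane and the assembly (p2, gen 9)

If a generic `10`-point solid `G` has a `U_{3,7}` plane `P₀` (a `7`-point trace all of whose lines have `2` points), the
three points `O = G ∖ P₀` are non-collinear (genericity), so `Q_O = cl(O)` is a plane meeting `τ = P₀ ∩ G` in `≤ 2`
points; pick `a ∈ τ` off `Q_O` and `x ∈ O`.  For each of the `6` points `b ≠ a` of `τ` the plane `Q_b = cl{a, b, x}`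
meets `τ` exactly in `{a, b}`; it contains another outside point `w` only if `b` lies on the plane `R_w = cl{a, x, w}`
(`{a, x, w}` has rank `3`: `w ∈ cl{a, x}` would give `a ∈ cl{x, w} ⊆ Q_O` by exchange), which meets `τ` in `≤ 2` points —
at most one `b` per `w`, so at most `2` of the `6` planes are spoiled and a plane with trace exactly `{a, b, x}` exists
(`exists_three_point_plane`).  Two `U_{3,7}` planes cannot coexist in `10` points (`u37_unique`).  Hence
`J₃ ≥ Σ_P slack(P) ≥ −7/5 + 227/25 > 0` when a `U_{3,7}` exists and `≥ 0` otherwise (`J_three_nonneg_of_generic_ten`).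
-/

namespace PercRepro.SixFour

open Finset ThmH

variable {α : Type*} [DecidableEq α] {M : Matroid α} [M.Finite] {G : Finset α}

omit [DecidableEq α] in
/-- In a simple matroid a point is not in the closure of another point. -/
theorem notMem_closure_singleton (hs : Simple M) {x w : α} (hx : x ∈ gr M) (hw : w ∈ gr M) (hne : x ≠ w) :
    w ∉ M.closure ({x} : Set α) := by
  intro hwx
  have hxE : x ∈ M.E := by rw [← coe_gr M]; exact_mod_cast hx
  have hwE : w ∈ M.E := by rw [← coe_gr M]; exact_mod_cast hw
  have h2 := hs x hxE w hwE hne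
  have h1 : M.eRk ({x, w} : Set α) ≤ M.eRk ({x} : Set α) := by
    rw [← M.eRk_closure_eq ({x} : Set α)]
    refine M.eRk_mono ?_
    intro z hz
    rw [Set.mem_insert_iff, Set.mem_singleton_iff] at hz
    rcases hz with rfl | rfl
    · exact M.subset_closure _ (by simpa using hxE) rfl
    · exact hwx
  have hle := M.eRk_le_encard ({x} : Set α)
  rw [Set.encard_singleton] at hle
  rw [h2] at h1
  have : (2 : ℕ∞) ≤ 1 := h1.trans hle
  exact absurd this (by decide)

/-- The rank of a pair of distinct points of a simple matroid, in finset form. -/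
theorem eRk_pair_eq_two (hs : Simple M) {a x : α} (ha : a ∈ gr M) (hx : x ∈ gr M) (hax : a ≠ x) :
    M.eRk (({a, x} : Finset α) : Set α) = 2 := by
  rw [show (({a, x} : Finset α) : Set α) = ({a, x} : Set α) by simp]
  exact hs a (by rw [← coe_gr M]; exact_mod_cast ha) x (by rw [← coe_gr M]; exact_mod_cast hx) hax

section Ten

variable (hs : Simple M) (hG : G ⊆ gr M) {P₀ : Finset α} (hP₀ : P₀ ∈ planes M)
  (hall : ∀ L ∈ lines M, (L ∩ (P₀ ∩ G)).card ≤ 2)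
include hs hG hP₀ hall

omit hP₀ in
/-- In a `U_{3,7}` trace, a subset of rank `≤ 2` has at most `2` points. -/
theorem card_le_two_of_eRk_le_two_u37 {Z : Finset α} (hZ : Z ⊆ P₀ ∩ G) (hr2 : M.eRk (Z : Set α) ≤ 2) :
    Z.card ≤ 2 := by
  by_contra h
  push Not at h
  obtain ⟨a, ha, b, hb, hab⟩ := Finset.one_lt_card.1 (by omega : 1 < Z.card)
  have hZg : Z ⊆ gr M := hZ.trans (Finset.inter_subset_right.trans hG)
  have hab_sub : ({a, b} : Finset α) ⊆ Z := by
    intro z hz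
    rw [Finset.mem_insert, Finset.mem_singleton] at hz
    rcases hz with rfl | rfl <;> assumption
  have hab2 : M.eRk (({a, b} : Finset α) : Set α) = 2 := eRk_pair_eq_two hs (hZg ha) (hZg hb) hab
  obtain ⟨hL, hsub⟩ := clF_mem_lines (hab_sub.trans hZg) hab2
  have hZE : (Z : Set α) ⊆ M.E := by rw [← coe_gr M]; exact_mod_cast hZg
  have hcl : M.closure (({a, b} : Finset α) : Set α) = M.closure (Z : Set α) := by
    apply closure_eq_of_subset_flat (M.isFlat_closure _)
      ((Finset.coe_subset.2 hab_sub).trans (M.subset_closure _ hZE)) (Finset.finite_toSet _)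
    rw [M.eRk_closure_eq, hab2]
    exact hr2
  have hZL : Z ⊆ clF M {a, b} := by
    intro z hz
    rw [← Finset.mem_coe, coe_clF, hcl]
    exact M.subset_closure _ hZE (Finset.mem_coe.2 hz)
  have h1 := hall _ hL
  have h2 := Finset.card_le_card (Finset.subset_inter hZL hZ)
  omega

/-- A plane `Q ≠ P₀` meets the `U_{3,7}` trace in at most `2` points. -/
theorem card_inter_le_two_u37 {Q : Finset α} (hQ : Q ∈ planes M) (hne : Q ≠ P₀) : (Q ∩ (P₀ ∩ G)).card ≤ 2 := by
  apply card_le_two_of_eRk_le_two_u37 hs hG hall Finset.inter_subset_right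
  have hle := eRk_inter_le_two_of_ne hQ hP₀ hne
  calc M.eRk ((Q ∩ (P₀ ∩ G) : Finset α) : Set α) ≤ M.eRk ((Q ∩ P₀ : Finset α) : Set α) :=
        M.eRk_mono (Finset.coe_subset.2 (fun z hz => by
          rw [Finset.mem_inter] at hz ⊢; exact ⟨hz.1, (Finset.mem_inter.1 hz.2).1⟩))
    _ ≤ 2 := hle

/-- The plane through a pair of the trace and a point off `P₀` meets the trace exactly in that pair. -/
theorem inter_eq_pair_u37 {a b x : α} (ha : a ∈ P₀ ∩ G) (hb : b ∈ P₀ ∩ G) (hab : a ≠ b) (hx : x ∈ G) (hxP : x ∉ P₀) :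
    M.eRk ((insert x ({a, b} : Finset α) : Finset α) : Set α) = 3 ∧
      clF M (insert x ({a, b} : Finset α)) ∈ planes M ∧ insert x ({a, b} : Finset α) ⊆ clF M (insert x {a, b}) ∧
      clF M (insert x ({a, b} : Finset α)) ∩ (P₀ ∩ G) = {a, b} := by
  have haP : a ∈ P₀ := (Finset.mem_inter.1 ha).1
  have hbP : b ∈ P₀ := (Finset.mem_inter.1 hb).1
  have haG : a ∈ G := (Finset.mem_inter.1 ha).2
  have hbG : b ∈ G := (Finset.mem_inter.1 hb).2
  have h2 : M.eRk (({a, b} : Finset α) : Set α) = 2 := eRk_pair_eq_two hs (hG haG) (hG hbG) hab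
  have hsubP : ({a, b} : Finset α) ⊆ P₀ := by
    intro z hz; rw [Finset.mem_insert, Finset.mem_singleton] at hz; rcases hz with rfl | rfl <;> assumption
  have h3 : M.eRk ((insert x ({a, b} : Finset α) : Finset α) : Set α) = 3 := by
    rw [eRk_insert_of_notMem_plane hP₀ hsubP (hG hx) hxP, h2]
    norm_num
  have hsubg : insert x ({a, b} : Finset α) ⊆ gr M := by
    intro z hz; rw [Finset.mem_insert, Finset.mem_insert, Finset.mem_singleton] at hz
    rcases hz with rfl | rfl | rfl
    · exact hG hx
    · exact hG haG
    · exact hG hbG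
  obtain ⟨hQ, hQsub⟩ := clF_mem_planes hsubg h3
  refine ⟨h3, hQ, hQsub, ?_⟩
  have hne : clF M (insert x ({a, b} : Finset α)) ≠ P₀ := fun h => hxP (h ▸ hQsub (by simp))
  have hle := card_inter_le_two_u37 hs hG hP₀ hall hQ hne
  have hsub : ({a, b} : Finset α) ⊆ clF M (insert x ({a, b} : Finset α)) ∩ (P₀ ∩ G) := by
    intro z hz
    rw [Finset.mem_inter]
    refine ⟨hQsub (Finset.mem_insert_of_mem hz), ?_⟩
    rw [Finset.mem_insert, Finset.mem_singleton] at hz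
    rcases hz with rfl | rfl <;> assumption
  symm
  apply Finset.eq_of_subset_of_card_le hsub
  rw [Finset.card_pair hab]
  exact hle

/-- **A `3`-point plane exists** in a generic `10`-point solid with a `U_{3,7}` plane. -/
theorem exists_three_point_plane (hgen : Generic M G) (hg : G.card = 10) (h7 : (P₀ ∩ G).card = 7) :
    ∃ Q ∈ planes M, M.eRk ((Q ∩ G : Finset α) : Set α) = 3 ∧ (Q ∩ G).card = 3 := by
  have hOg : (G \ P₀) ⊆ gr M := Finset.sdiff_subset.trans hG
  have hO3 : (G \ P₀).card = 3 := by
    have := Finset.card_sdiff_add_card_inter G P₀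
    rw [Finset.inter_comm] at this
    omega
  have hOr : M.eRk ((G \ P₀ : Finset α) : Set α) = 3 := by
    have hge := hgen P₀ hP₀
    have hle := M.eRk_le_encard ((G \ P₀ : Finset α) : Set α)
    rw [Set.encard_coe_eq_coe_finsetCard, hO3] at hle
    exact le_antisymm (by exact_mod_cast hle) hge
  obtain ⟨hQO, hOsub⟩ := clF_mem_planes hOg hOr
  set QO := clF M (G \ P₀) with hQOdef
  obtain ⟨x, hxO⟩ := Finset.card_pos.1 (by omega : 0 < (G \ P₀).card)
  have hxG : x ∈ G := (Finset.mem_sdiff.1 hxO).1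
  have hxP : x ∉ P₀ := (Finset.mem_sdiff.1 hxO).2
  have hQOne : QO ≠ P₀ := fun h => hxP (h ▸ hOsub hxO)
  have hQOτ := card_inter_le_two_u37 hs hG hP₀ hall hQO hQOne
  -- `a ∈ (P₀ ∩ G)` off `Q_O`
  obtain ⟨a, haτ, haQ⟩ : ∃ a ∈ (P₀ ∩ G), a ∉ QO := by
    by_contra hcon
    push Not at hcon
    have hsub : (P₀ ∩ G) ⊆ QO ∩ (P₀ ∩ G) := fun z hz => Finset.mem_inter.2 ⟨hcon z hz, hz⟩
    have := Finset.card_le_card hsub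
    omega
  have haP : a ∈ P₀ := (Finset.mem_inter.1 haτ).1
  have haG : a ∈ G := (Finset.mem_inter.1 haτ).2
  have hax : a ≠ x := fun h => hxP (h ▸ haP)
  -- the spoiling planes `R_w = cl{a, x, w}`, `w ∈ (G \ P₀) ∖ {x}`
  have hR : ∀ w ∈ (G \ P₀).erase x, M.eRk ((insert w ({a, x} : Finset α) : Finset α) : Set α) = 3 ∧
      clF M (insert w ({a, x} : Finset α)) ∈ planes M ∧ insert w ({a, x} : Finset α) ⊆ clF M (insert w {a, x}) ∧
      ((clF M (insert w ({a, x} : Finset α)) ∩ (P₀ ∩ G)).erase a).card ≤ 1 := by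
    intro w hw
    rw [Finset.mem_erase] at hw
    have hwG : w ∈ G := (Finset.mem_sdiff.1 hw.2).1
    have hwP : w ∉ P₀ := (Finset.mem_sdiff.1 hw.2).2
    have hax2 : M.eRk (({a, x} : Finset α) : Set α) = 2 := eRk_pair_eq_two hs (hG haG) (hG hxG) hax
    -- `w ∉ cl{a, x}`: otherwise `a ∈ cl{x, w} ⊆ Q_O` by exchange
    have hwcl : w ∉ M.closure (({a, x} : Finset α) : Set α) := by
      intro hwin
      have hwx : w ∉ M.closure (({x} : Finset α) : Set α) := by
        rw [Finset.coe_singleton]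
        exact notMem_closure_singleton hs (hG hxG) (hG hwG) (fun h => hw.1 h.symm)
      have hmem : w ∈ M.closure (insert a (({x} : Finset α) : Set α)) \ M.closure (({x} : Finset α) : Set α) := by
        refine ⟨?_, hwx⟩
        have : (insert a (({x} : Finset α) : Set α)) = (({a, x} : Finset α) : Set α) := by simp
        rw [this]; exact hwin
      have hex := Matroid.closure_exchange hmem
      apply haQ
      rw [← Finset.mem_coe, hQOdef, coe_clF]
      refine M.closure_subset_closure ?_ hex.1
      intro z hz
      rw [Set.mem_insert_iff, Finset.coe_singleton, Set.mem_singleton_iff] at hz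
      rcases hz with rfl | rfl
      · exact Finset.mem_coe.2 hw.2
      · exact Finset.mem_coe.2 hxO
    have h3 : M.eRk ((insert w ({a, x} : Finset α) : Finset α) : Set α) = 3 := by
      rw [Finset.coe_insert, Matroid.eRk_insert_eq_add_one ⟨by rw [← coe_gr M]; exact_mod_cast hG hwG, hwcl⟩, hax2]
      norm_num
    have hsubg : insert w ({a, x} : Finset α) ⊆ gr M := by
      intro z hz; rw [Finset.mem_insert, Finset.mem_insert, Finset.mem_singleton] at hz
      rcases hz with rfl | rfl | rfl
      · exact hG hwG
      · exact hG haG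
      · exact hG hxG
    obtain ⟨hRw, hRsub⟩ := clF_mem_planes hsubg h3
    refine ⟨h3, hRw, hRsub, ?_⟩
    have hne : clF M (insert w ({a, x} : Finset α)) ≠ P₀ := fun h => hwP (h ▸ hRsub (by simp))
    have hle := card_inter_le_two_u37 hs hG hP₀ hall hRw hne
    have hamem : a ∈ clF M (insert w ({a, x} : Finset α)) ∩ (P₀ ∩ G) := Finset.mem_inter.2 ⟨hRsub (by simp), haτ⟩
    rw [Finset.card_erase_of_mem hamem]
    omega
  -- the bad `b`: those on some `R_w`
  set bad := ((G \ P₀).erase x).biUnion (fun w => (clF M (insert w ({a, x} : Finset α)) ∩ (P₀ ∩ G)).erase a) with hbad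
  have hbadcard : bad.card ≤ 2 := by
    calc bad.card ≤ ∑ w ∈ (G \ P₀).erase x, ((clF M (insert w ({a, x} : Finset α)) ∩ (P₀ ∩ G)).erase a).card :=
          Finset.card_biUnion_le
      _ ≤ ∑ w ∈ (G \ P₀).erase x, 1 := Finset.sum_le_sum (fun w hw => (hR w hw).2.2.2)
      _ = 2 := by rw [Finset.sum_const, smul_eq_mul, mul_one, Finset.card_erase_of_mem hxO, hO3]
  have hτa : ((P₀ ∩ G).erase a).card = 6 := by rw [Finset.card_erase_of_mem haτ, h7]
  obtain ⟨b, hb, hbbad⟩ := Finset.exists_mem_notMem_of_card_lt_card (show bad.card < ((P₀ ∩ G).erase a).card by omega)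
  rw [Finset.mem_erase] at hb
  obtain ⟨h3, hQ, hQsub, hQτ⟩ := inter_eq_pair_u37 hs hG hP₀ hall haτ hb.2 (fun h => hb.1 h.symm) hxG hxP
  refine ⟨clF M (insert x ({a, b} : Finset α)), hQ, ?_, ?_⟩
  -- the trace is exactly `{a, b, x}`
  · have heq : clF M (insert x ({a, b} : Finset α)) ∩ G = insert x ({a, b} : Finset α) := by
      ext z
      rw [Finset.mem_inter]
      constructor
      · rintro ⟨hzQ, hzG⟩
        by_cases hzP : z ∈ P₀
        · have : z ∈ clF M (insert x ({a, b} : Finset α)) ∩ (P₀ ∩ G) := Finset.mem_inter.2 ⟨hzQ, Finset.mem_inter.2 ⟨hzP, hzG⟩⟩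
          rw [hQτ] at this
          exact Finset.mem_insert_of_mem this
        · have hzO : z ∈ (G \ P₀) := Finset.mem_sdiff.2 ⟨hzG, hzP⟩
          by_cases hzx : z = x
          · rw [hzx]; exact Finset.mem_insert_self _ _
          · exfalso
            apply hbbad
            rw [hbad, Finset.mem_biUnion]
            refine ⟨z, Finset.mem_erase.2 ⟨hzx, hzO⟩, ?_⟩
            -- `z ∈ Q_b` forces `Q_b = R_z`, so `b ∈ R_z ∩ (P₀ ∩ G)`
            obtain ⟨h3z, hRz, hRzsub, -⟩ := hR z (Finset.mem_erase.2 ⟨hzx, hzO⟩)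
            have hsub3 : insert z ({a, x} : Finset α) ⊆ clF M (insert x ({a, b} : Finset α)) := by
              intro y hy; rw [Finset.mem_insert, Finset.mem_insert, Finset.mem_singleton] at hy
              rcases hy with rfl | rfl | rfl
              · exact hzQ
              · exact hQsub (by simp)
              · exact hQsub (by simp)
            have heqQ := planes_eq_of_subset hQ hRz hsub3 hRzsub h3z
            rw [Finset.mem_erase, Finset.mem_inter]
            refine ⟨hb.1, ?_, hb.2⟩
            rw [← heqQ]
            exact hQsub (by simp)
      · intro hz
        exact ⟨hQsub hz, by
          rw [Finset.mem_insert, Finset.mem_insert, Finset.mem_singleton] at hz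
          rcases hz with rfl | rfl | rfl
          · exact hxG
          · exact haG
          · exact (Finset.mem_inter.1 hb.2).2⟩
    rw [heq]
    exact h3
  · have heq : clF M (insert x ({a, b} : Finset α)) ∩ G = insert x ({a, b} : Finset α) := by
      -- (repeated: the same identity)
      ext z
      rw [Finset.mem_inter]
      constructor
      · rintro ⟨hzQ, hzG⟩
        by_cases hzP : z ∈ P₀
        · have : z ∈ clF M (insert x ({a, b} : Finset α)) ∩ (P₀ ∩ G) := Finset.mem_inter.2 ⟨hzQ, Finset.mem_inter.2 ⟨hzP, hzG⟩⟩
          rw [hQτ] at this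
          exact Finset.mem_insert_of_mem this
        · have hzO : z ∈ (G \ P₀) := Finset.mem_sdiff.2 ⟨hzG, hzP⟩
          by_cases hzx : z = x
          · rw [hzx]; exact Finset.mem_insert_self _ _
          · exfalso
            apply hbbad
            rw [hbad, Finset.mem_biUnion]
            refine ⟨z, Finset.mem_erase.2 ⟨hzx, hzO⟩, ?_⟩
            obtain ⟨h3z, hRz, hRzsub, -⟩ := hR z (Finset.mem_erase.2 ⟨hzx, hzO⟩)
            have hsub3 : insert z ({a, x} : Finset α) ⊆ clF M (insert x ({a, b} : Finset α)) := by
              intro y hy; rw [Finset.mem_insert, Finset.mem_insert, Finset.mem_singleton] at hy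
              rcases hy with rfl | rfl | rfl
              · exact hzQ
              · exact hQsub (by simp)
              · exact hQsub (by simp)
            have heqQ := planes_eq_of_subset hQ hRz hsub3 hRzsub h3z
            rw [Finset.mem_erase, Finset.mem_inter]
            refine ⟨hb.1, ?_, hb.2⟩
            rw [← heqQ]
            exact hQsub (by simp)
      · intro hz
        exact ⟨hQsub hz, by
          rw [Finset.mem_insert, Finset.mem_insert, Finset.mem_singleton] at hz
          rcases hz with rfl | rfl | rfl
          · exact hxG
          · exact haG
          · exact (Finset.mem_inter.1 hb.2).2⟩
    rw [heq, Finset.card_insert_of_notMem (by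
      rw [Finset.mem_insert, Finset.mem_singleton]
      rintro (rfl | rfl)
      · exact hxP haP
      · exact hxP (Finset.mem_inter.1 hb.2).1), Finset.card_pair (fun h => hb.1 h.symm)]

/-- Two `U_{3,7}` planes cannot coexist in a `10`-point set. -/
theorem u37_unique (hg : G.card = 10) (h7 : (P₀ ∩ G).card = 7) {P₁ : Finset α} (hP₁ : P₁ ∈ planes M)
    (h7' : (P₁ ∩ G).card = 7) : P₁ = P₀ := by
  by_contra hne
  have hle := card_inter_le_two_u37 hs hG hP₀ hall hP₁ hne
  have hunion := Finset.card_union_add_card_inter (P₁ ∩ G) (P₀ ∩ G)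
  have hsub : (P₁ ∩ G) ∪ (P₀ ∩ G) ⊆ G := Finset.union_subset Finset.inter_subset_right Finset.inter_subset_right
  have h1 := Finset.card_le_card hsub
  have heq : (P₁ ∩ G) ∩ (P₀ ∩ G) = P₁ ∩ (P₀ ∩ G) := by
    ext z
    simp only [Finset.mem_inter]
    tauto
  rw [heq] at hunion
  omega

end Ten

/-- **Theorem G₃ at `g = 10`**: `0 ≤ J₃(G)` for every generic rank-`4` set `G ⊆ E` of a simple matroid with `10` points. -/
theorem J_three_nonneg_of_generic_ten (hs : Simple M) (hG : G ⊆ gr M) (hr : M.eRk (G : Set α) = 4)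
    (hgen : Generic M G) (hg : G.card = 10) : 0 ≤ J M G 3 := by
  have hsum := J_three_ge_sum_slack hs hG hr hgen (by omega)
  set S := (planes M).filter (fun P : Finset α => M.eRk ((P ∩ G : Finset α) : Set α) = 3) with hS
  by_cases hU : ∃ P ∈ S, (P ∩ G).card = 7 ∧ ∀ L ∈ lines M, (L ∩ (P ∩ G)).card ≤ 2
  · obtain ⟨P₀, hP₀S, h7, hall⟩ := hU
    obtain ⟨hP₀, hr3⟩ := Finset.mem_filter.1 hP₀S
    obtain ⟨Q, hQ, hQr, hQ3⟩ := exists_three_point_plane hs hG hP₀ hall hgen hg h7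
    have hQS : Q ∈ S := Finset.mem_filter.2 ⟨hQ, hQr⟩
    have hQne : Q ≠ P₀ := fun h => by rw [h] at hQ3; omega
    have hpt : ∀ P ∈ S, (if P = P₀ then (-7 / 5 : ℚ) else if P = Q then 227 / 25 else 0) ≤ slack3 M G P := by
      intro P hPS
      obtain ⟨hP, hr3'⟩ := Finset.mem_filter.1 hPS
      split_ifs with h1 h2
      · subst h1; exact (slack_eq_of_seven_u37 hs hG hg hr3' h7 hall).ge
      · subst h2; exact (slack_eq_of_three hs hG hg hr3' hQ3).ge
      · by_cases h7' : (P ∩ G).card = 7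
        · by_cases hall' : ∀ L ∈ lines M, (L ∩ (P ∩ G)).card ≤ 2
          · exact absurd (u37_unique hs hG hP₀ hall hg h7 hP h7') h1
          · push Not at hall'
            obtain ⟨L, hL, hL3⟩ := hall'
            exact slack_nonneg_of_seven_of_line hs hG hg hr3' h7' hL (by omega)
        · exact slack_nonneg_of_ne_seven hs hG hgen hg hP hr3' h7'
    have hsum2 := Finset.sum_le_sum hpt
    have hval : ∑ P ∈ S, (if P = P₀ then (-7 / 5 : ℚ) else if P = Q then 227 / 25 else 0) = -7 / 5 + 227 / 25 := by
      rw [← Finset.add_sum_erase S _ hP₀S, if_pos rfl,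
        ← Finset.add_sum_erase (S.erase P₀) _ (Finset.mem_erase.2 ⟨hQne, hQS⟩), if_neg hQne, if_pos rfl]
      have hrest : ∑ x ∈ (S.erase P₀).erase Q, (if x = P₀ then (-7 / 5 : ℚ) else if x = Q then 227 / 25 else 0) = 0 := by
        apply Finset.sum_eq_zero
        intro x hx
        rw [Finset.mem_erase, Finset.mem_erase] at hx
        rw [if_neg hx.2.1, if_neg hx.1]
      rw [hrest]
      ring
    linarith
  · push Not at hU
    have hpt : ∀ P ∈ S, (0 : ℚ) ≤ slack3 M G P := by
      intro P hPS
      obtain ⟨hP, hr3'⟩ := Finset.mem_filter.1 hPS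
      by_cases h7' : (P ∩ G).card = 7
      · obtain ⟨L, hL, hL3⟩ := hU P hPS h7'
        exact slack_nonneg_of_seven_of_line hs hG hg hr3' h7' hL (by omega)
      · exact slack_nonneg_of_ne_seven hs hG hgen hg hP hr3' h7'
    have := Finset.sum_nonneg hpt
    linarith

end PercRepro.SixFour
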